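import Literature.NumberTheory.Sieve.RamanujanSum
import Literature.NumberTheory.Sieve.SingularSeriesProofs
import Mathlib.NumberTheory.EulerProduct.Basic
import Mathlib.Analysis.SpecialFunctions.Pow.Real
import Mathlib.Analysis.PSeries
import HarnessLib

/-!
# The singular series of the prime-pair problem as a Ramanujan-sum series

Trunk AntSieve, topic `Literature/NumberTheory/Sieve`. This file proves the "standard Euler
product calculation" closing the proof of Matomäki–Radziwiłł–Tao 2019, Prop. 3.3(i) (arXiv p. 21):

* `∑_{q ≥ 1} μ²(q) c_q(h) / φ(q)² = 𝔖(h)` for `h ≠ 0`, where `𝔖(h) = 2Π₂ ∏_{p ∣ h, p>2} (p-1)/(p-2)`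
  for even `h` and `𝔖(h) = 0` for odd `h` (MRT eq. (7); here `Literature.goldbachSingularSeries h`), as a
  `HasSum` statement (`hasSum_goldbachSeriesTerm`);
* the Rankin-type bound `∑_q q^{1/2} |μ²(q) c_q(h)/φ(q)²| ≤ K · 4^{ω(h)} ≤ K · d(h)²`
  (`tsum_goldbachWeight_le`), whence the tail estimate
  `|𝔖(h) - ∑_{q ≤ Q} μ²(q) c_q(h)/φ(q)²| ≤ K d(h)² Q^{-1/2}` (`abs_goldbachSingularSeries_sub_sum_le`)
  and the crude bound `∑_{q ≤ Q} |μ²(q) c_q(h)/φ(q)²| ≤ K d(h)²` — MRT: "`∑_q μ²(q) c_q(h) q^{1/2}/φ²(q)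
  ≪ ∏_{p ∤ h}(1 + O(p^{-3/2})) × ∏_{p ∣ h} O(1) ≪ d₂(h)^{O(1)}` and hence
  `∑_{q > log^B X} μ²(q) c_q(h)/φ²(q) ≪ d₂(h)^{O(1)} log^{-B/2} X`".

## Proof sketch

`g_h(q) ≔ μ²(q) c_q(h)/φ(q)²` is multiplicative in `q`, supported on squarefree `q`, with
`g_h(p) = 1/(p-1)` for `p ∣ h` and `g_h(p) = -1/(p-1)²` for `p ∤ h` (`ramanujanDivisorSum_prime`).
For a non-negative multiplicative `F` supported on squarefrees, `∑_{q<N} F(q) ≤ ∏_{p<N} (1 + F(p))`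
(expand the product over subsets); with `F(q) = q^{1/2}|g_h(q)|` the Euler factors are `≤ 4` at the
`ω(h)` primes dividing `h` and `≤ exp(4 p^{-3/2})` elsewhere, giving summability and the bound.
Mathlib's `ArithmeticFunction.IsMultiplicative.eulerProduct` then identifies `∑_q g_h(q)` with
`lim_N ∏_{p<N} (1 + g_h(p))`; for odd `h` the factor at `p = 2` vanishes, and for even `h` the partial
product over `p ≤ m` (`m ≥ h`) equals `2 · ∏_{2<p≤m}(1 - 1/(p-1)²) · ∏_{p ∣ h, p>2} (p-1)/(p-2)`, which
tends to `goldbachSingularSeries h` by `Literature.NumberTheory.Sieve.tendsto_twinPrimeConstPartial_holds`.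

## References

* K. Matomäki, M. Radziwiłł, T. Tao, *Correlations of the von Mangoldt and higher divisor
  functions I*, Proc. LMS 118 (2019), proof of Prop. 3.3(i), arXiv:1707.01315 p. 21; eq. (7) p. 3.
* G. H. Hardy, J. E. Littlewood, *Partitio Numerorum III*, Acta Math. 44 (1923) (the singular series).
-/

noncomputable section

open scoped ArithmeticFunction.Moebius Topology
open Finset ArithmeticFunction Filter

namespace Literature.NumberTheory.Sieve

/-! ### The summand `μ²(q) c_q(h) / φ(q)²` -/

/-- The general term `g_h(q) = μ(q)² c_q(h) / φ(q)²` of the Ramanujan-sum expansion of the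
prime-pair singular series, as a real arithmetic function of `q` (Matomäki–Radziwiłł–Tao 2019,
proof of Prop. 3.3(i): "the left-hand side simplifies to `∑_{q ≤ log^B X} μ²(q) c_q(h)/φ²(q)`").
[cite: MatomakiRadziwillTao2019, §4, p. 21 (arXiv)] -/
def goldbachSeriesTerm (h : ℕ) : ArithmeticFunction ℝ :=
  ⟨fun q ↦ (μ q : ℝ) ^ 2 * (ramanujanDivisorSum h q : ℝ) / (q.totient : ℝ) ^ 2, by simp⟩

/-- Unfolding lemma for `goldbachSeriesTerm`. [folklore] -/
theorem goldbachSeriesTerm_apply (h q : ℕ) :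
    goldbachSeriesTerm h q = (μ q : ℝ) ^ 2 * (ramanujanDivisorSum h q : ℝ) / (q.totient : ℝ) ^ 2 :=
  rfl

/-- `g_h` is multiplicative in `q` (product of the multiplicative `μ²`, `c_·(h)`, `φ^{-2}`).
[cite: MatomakiRadziwillTao2019, §4, p. 21 (arXiv)] -/
theorem isMultiplicative_goldbachSeriesTerm (h : ℕ) : (goldbachSeriesTerm h).IsMultiplicative := by
  refine ⟨?_, fun {m n} hmn ↦ ?_⟩
  · rw [goldbachSeriesTerm_apply, (isMultiplicative_ramanujanDivisorSum h).map_one,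
      ArithmeticFunction.moebius_apply_one, Nat.totient_one]
    norm_num
  · rw [goldbachSeriesTerm_apply, goldbachSeriesTerm_apply, goldbachSeriesTerm_apply,
      (isMultiplicative_ramanujanDivisorSum h).map_mul_of_coprime hmn,
      ArithmeticFunction.isMultiplicative_moebius.map_mul_of_coprime hmn, Nat.totient_mul hmn]
    push_cast
    ring

/-- `g_h(q) = 0` unless `q` is squarefree. [folklore] -/
theorem goldbachSeriesTerm_eq_zero_of_not_squarefree (h : ℕ) {q : ℕ} (hq : ¬Squarefree q) :
    goldbachSeriesTerm h q = 0 := by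
  rw [goldbachSeriesTerm_apply, ArithmeticFunction.moebius_eq_zero_of_not_squarefree hq]
  simp

/-- Prime values: `g_h(p) = 1/(p-1)` if `p ∣ h`, and `g_h(p) = -1/(p-1)²` if `p ∤ h`
(from `c_p(h) = p - 1`, resp. `-1`, `μ(p)² = 1`, `φ(p) = p - 1`). [cite: MatomakiRadziwillTao2019, §4, p. 21 (arXiv)] -/
theorem goldbachSeriesTerm_prime (h : ℕ) {p : ℕ} (hp : p.Prime) :
    goldbachSeriesTerm h p =
      if p ∣ h then 1 / ((p : ℝ) - 1) else -1 / ((p : ℝ) - 1) ^ 2 := by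
  have hp1 : ((p - 1 : ℕ) : ℝ) = (p : ℝ) - 1 := by
    rw [Nat.cast_sub hp.one_le, Nat.cast_one]
  have hp0 : (p : ℝ) - 1 ≠ 0 := by
    have : (2 : ℝ) ≤ p := by exact_mod_cast hp.two_le
    linarith
  rw [goldbachSeriesTerm_apply, ramanujanDivisorSum_prime h hp, Nat.totient_prime hp, hp1,
    ArithmeticFunction.moebius_apply_prime hp]
  split_ifs
  · push_cast
    field_simp
  · push_cast
    field_simp

/-! ### A Rankin-weighted majorant and its Euler-product bound -/

/-- The non-negative multiplicative majorant `F_h(q) = q^{1/2} |g_h(q)|` (Rankin's trick with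
weight `q^{1/2}`, as in Matomäki–Radziwiłł–Tao 2019, p. 21). [cite: MatomakiRadziwillTao2019, §4, p. 21 (arXiv)] -/
def goldbachWeight (h : ℕ) : ArithmeticFunction ℝ :=
  ⟨fun q ↦ Real.sqrt q * |goldbachSeriesTerm h q|, by simp⟩

/-- Unfolding lemma for `goldbachWeight`. [folklore] -/
theorem goldbachWeight_apply (h q : ℕ) :
    goldbachWeight h q = Real.sqrt q * |goldbachSeriesTerm h q| := rfl

/-- `F_h ≥ 0`. [folklore] -/
theorem goldbachWeight_nonneg (h q : ℕ) : 0 ≤ goldbachWeight h q :=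
  mul_nonneg (Real.sqrt_nonneg _) (abs_nonneg _)

/-- `F_h` is multiplicative. [folklore] -/
theorem isMultiplicative_goldbachWeight (h : ℕ) : (goldbachWeight h).IsMultiplicative := by
  refine ⟨?_, fun {m n} hmn ↦ ?_⟩
  · rw [goldbachWeight_apply, (isMultiplicative_goldbachSeriesTerm h).map_one]
    simp
  · rw [goldbachWeight_apply, goldbachWeight_apply, goldbachWeight_apply,
      (isMultiplicative_goldbachSeriesTerm h).map_mul_of_coprime hmn, Nat.cast_mul,
      Real.sqrt_mul (Nat.cast_nonneg m), abs_mul]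
    ring

/-- `F_h(q) = 0` unless `q` is squarefree. [folklore] -/
theorem goldbachWeight_eq_zero_of_not_squarefree (h : ℕ) {q : ℕ} (hq : ¬Squarefree q) :
    goldbachWeight h q = 0 := by
  rw [goldbachWeight_apply, goldbachSeriesTerm_eq_zero_of_not_squarefree h hq, abs_zero, mul_zero]

/-- `|g_h(q)| ≤ F_h(q)` (as `q^{1/2} ≥ 1` for `q ≥ 1`, both sides vanishing at `q = 0`). [folklore] -/
theorem abs_goldbachSeriesTerm_le_goldbachWeight (h q : ℕ) :
    |goldbachSeriesTerm h q| ≤ goldbachWeight h q := by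
  rcases Nat.eq_zero_or_pos q with rfl | hq
  · simp
  · rw [goldbachWeight_apply]
    have : (1 : ℝ) ≤ Real.sqrt q := Real.one_le_sqrt.mpr (by exact_mod_cast hq)
    nlinarith [abs_nonneg (goldbachSeriesTerm h q)]

namespace GoldbachSeries

/-- **Finite Euler-product majorisation.** For a non-negative multiplicative arithmetic function
`F` vanishing off the squarefree integers, `∑_{q < N} F(q) ≤ ∏_{p < N} (1 + F(p))`: expanding the
product over subsets `T` of the primes below `N` produces every squarefree `q < N` (as
`T = ` its set of prime factors) exactly once, with non-negative surplus. [folklore] -/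
theorem sum_range_le_prod_primesBelow {F : ArithmeticFunction ℝ} (hF : F.IsMultiplicative)
    (hF0 : ∀ q, 0 ≤ F q) (hFsq : ∀ q, ¬Squarefree q → F q = 0) (N : ℕ) :
    ∑ q ∈ range N, F q ≤ ∏ p ∈ N.primesBelow, (1 + F p) := by
  classical
  rw [prod_one_add]
  calc ∑ q ∈ range N, F q = ∑ q ∈ (range N).filter Squarefree, F q := by
        rw [sum_filter_of_ne]
        intro q _ hq
        by_contra hsq
        exact hq (hFsq q hsq)
    _ = ∑ q ∈ (range N).filter Squarefree, ∏ p ∈ q.primeFactors, F p := by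
        refine sum_congr rfl fun q hq ↦ ?_
        have hsq : Squarefree q := (mem_filter.mp hq).2
        rw [← hF.map_prod_of_subset_primeFactors q q.primeFactors Subset.rfl,
          Nat.prod_primeFactors_of_squarefree hsq]
    _ = ∑ T ∈ ((range N).filter Squarefree).image Nat.primeFactors, ∏ p ∈ T, F p := by
        rw [sum_image]
        intro q₁ hq₁ q₂ hq₂ heq
        have h₁ : Squarefree q₁ := (mem_filter.mp hq₁).2
        have h₂ : Squarefree q₂ := (mem_filter.mp hq₂).2
        rw [← Nat.prod_primeFactors_of_squarefree h₁, ← Nat.prod_primeFactors_of_squarefree h₂]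
        exact congrArg (fun T : Finset ℕ ↦ ∏ p ∈ T, p) heq
    _ ≤ ∑ T ∈ N.primesBelow.powerset, ∏ p ∈ T, F p := by
        refine sum_le_sum_of_subset_of_nonneg ?_ (fun T _ _ ↦ prod_nonneg fun p _ ↦ hF0 p)
        intro T hT
        obtain ⟨q, hq, rfl⟩ := mem_image.mp hT
        have hqN : q < N := mem_range.mp (mem_filter.mp hq).1
        rw [mem_powerset]
        intro p hp
        obtain ⟨hpp, hpq, hq0⟩ := Nat.mem_primeFactors.mp hp
        exact Nat.mem_primesBelow.mpr
          ⟨(Nat.le_of_dvd (Nat.pos_of_ne_zero hq0) hpq).trans_lt hqN, hpp⟩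

/-- Summability from a uniform Euler-product bound: if moreover `∏_{p < N} (1 + F(p)) ≤ M` for all
`N`, then `F` is summable and `∑_q F(q) ≤ M`. [folklore] -/
theorem summable_of_prod_primesBelow_le {F : ArithmeticFunction ℝ} (hF : F.IsMultiplicative)
    (hF0 : ∀ q, 0 ≤ F q) (hFsq : ∀ q, ¬Squarefree q → F q = 0) {M : ℝ}
    (hM : ∀ N : ℕ, ∏ p ∈ N.primesBelow, (1 + F p) ≤ M) :
    Summable (fun q ↦ F q) ∧ ∑' q, F q ≤ M := by
  have key : ∀ N, ∑ q ∈ range N, F q ≤ M :=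
    fun N ↦ (sum_range_le_prod_primesBelow hF hF0 hFsq N).trans (hM N)
  exact ⟨summable_of_sum_range_le hF0 key, Real.tsum_le_of_sum_range_le hF0 key⟩

end GoldbachSeries

open GoldbachSeries

/-- The absolute constant `K₀ = exp(∑_n 4 n^{-3/2})` bounding `∏_{p ∤ h} (1 + p^{1/2}/(p-1)²)`.
[folklore] -/
def goldbachWeightConst : ℝ :=
  Real.exp (∑' n : ℕ, 4 * ((n : ℝ) ^ (3 / 2 : ℝ))⁻¹)

namespace GoldbachSeries

/-- The majorant series `∑_n 4 n^{-3/2}` converges. [folklore] -/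
theorem summable_four_mul_rpow_inv :
    Summable (fun n : ℕ ↦ 4 * ((n : ℝ) ^ (3 / 2 : ℝ))⁻¹) :=
  (Real.summable_nat_rpow_inv.mpr (by norm_num)).mul_left 4

end GoldbachSeries

/-- Euler factor at a prime dividing `h`: `1 + p^{1/2}/(p-1) ≤ 4`. [folklore] -/
theorem goldbachWeight_prime_le_of_dvd (h : ℕ) {p : ℕ} (hp : p.Prime) (hph : p ∣ h) :
    1 + goldbachWeight h p ≤ 4 := by
  have hp2 : (2 : ℝ) ≤ p := by exact_mod_cast hp.two_le
  have hp1 : (0 : ℝ) < (p : ℝ) - 1 := by linarith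
  rw [goldbachWeight_apply, goldbachSeriesTerm_prime h hp, if_pos hph, abs_of_pos (by positivity)]
  have hsqrt : Real.sqrt p ≤ p := by
    rw [Real.sqrt_le_left (by linarith)]
    nlinarith
  have h3 : Real.sqrt p * (1 / ((p : ℝ) - 1)) ≤ 3 := by
    rw [mul_one_div, div_le_iff₀ hp1]
    nlinarith
  linarith

/-- Euler factor at a prime not dividing `h`: `1 + p^{1/2}/(p-1)² ≤ exp(4 p^{-3/2})`. [folklore] -/
theorem goldbachWeight_prime_le_of_not_dvd (h : ℕ) {p : ℕ} (hp : p.Prime) (hph : ¬p ∣ h) :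
    1 + goldbachWeight h p ≤ Real.exp (4 * ((p : ℝ) ^ (3 / 2 : ℝ))⁻¹) := by
  have hp2 : (2 : ℝ) ≤ p := by exact_mod_cast hp.two_le
  have hp0 : (0 : ℝ) < p := by linarith
  have hp1 : (0 : ℝ) < ((p : ℝ) - 1) ^ 2 := by nlinarith
  refine le_trans ?_ (Real.add_one_le_exp _)
  rw [add_comm, add_le_add_iff_right, goldbachWeight_apply, goldbachSeriesTerm_prime h hp,
    if_neg hph, neg_div, abs_neg]
  -- `√p / (p-1)² ≤ 4 / p^{3/2}` since `√p · p^{3/2} = p² ≤ 4 (p-1)²`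
  have h32 : (0 : ℝ) < (p : ℝ) ^ (3 / 2 : ℝ) := Real.rpow_pos_of_pos hp0 _
  have hmul : Real.sqrt p * (p : ℝ) ^ (3 / 2 : ℝ) = (p : ℝ) ^ 2 := by
    rw [Real.sqrt_eq_rpow, ← Real.rpow_add hp0, ← Real.rpow_natCast]
    norm_num
  have hkey : Real.sqrt p * (p : ℝ) ^ (3 / 2 : ℝ) ≤ 4 * ((p : ℝ) - 1) ^ 2 := by
    rw [hmul]
    nlinarith
  rw [abs_div, abs_one, abs_of_pos hp1, mul_one_div, div_le_iff₀ hp1]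
  calc Real.sqrt p = (Real.sqrt p * (p : ℝ) ^ (3 / 2 : ℝ)) * ((p : ℝ) ^ (3 / 2 : ℝ))⁻¹ := by
        field_simp
    _ ≤ (4 * ((p : ℝ) - 1) ^ 2) * ((p : ℝ) ^ (3 / 2 : ℝ))⁻¹ := by gcongr
    _ = 4 * ((p : ℝ) ^ (3 / 2 : ℝ))⁻¹ * ((p : ℝ) - 1) ^ 2 := by ring

/-- **Euler-product bound for the majorant**: `∏_{p < N} (1 + F_h(p)) ≤ K₀ · 4^{ω(h)}` for `h ≠ 0`,
where `ω(h) = #h.primeFactors` (Matomäki–Radziwiłł–Tao 2019, p. 21: "`≪ ∏_{p ∤ h}(1 + O(p^{-3/2}))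
× ∏_{p ∣ h} O(1)`"). [cite: MatomakiRadziwillTao2019, §4, p. 21 (arXiv)] -/
theorem prod_primesBelow_goldbachWeight_le {h : ℕ} (hh : h ≠ 0) (N : ℕ) :
    ∏ p ∈ N.primesBelow, (1 + goldbachWeight h p) ≤
      goldbachWeightConst * 4 ^ h.primeFactors.card := by
  have hpos : ∀ p ∈ N.primesBelow, 0 ≤ 1 + goldbachWeight h p :=
    fun p _ ↦ by linarith [goldbachWeight_nonneg h p]
  rw [← prod_filter_mul_prod_filter_not N.primesBelow (fun p ↦ p ∣ h), mul_comm]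
  refine mul_le_mul ?_ ?_ (prod_nonneg fun p hp ↦ hpos p (mem_filter.mp hp).1)
    (Real.exp_pos _).le
  · -- primes not dividing `h`
    calc ∏ p ∈ N.primesBelow with ¬p ∣ h, (1 + goldbachWeight h p)
        ≤ ∏ p ∈ N.primesBelow with ¬p ∣ h, Real.exp (4 * ((p : ℝ) ^ (3 / 2 : ℝ))⁻¹) := by
          refine prod_le_prod (fun p hp ↦ hpos p (mem_filter.mp hp).1) fun p hp ↦ ?_
          have hp' := mem_filter.mp hp
          exact goldbachWeight_prime_le_of_not_dvd h (Nat.mem_primesBelow.mp hp'.1).2 hp'.2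
      _ = Real.exp (∑ p ∈ N.primesBelow with ¬p ∣ h, 4 * ((p : ℝ) ^ (3 / 2 : ℝ))⁻¹) :=
          (Real.exp_sum _ _).symm
      _ ≤ goldbachWeightConst := by
          refine Real.exp_le_exp.mpr (Summable.sum_le_tsum _ (fun n _ ↦ ?_) summable_four_mul_rpow_inv)
          positivity
  · -- primes dividing `h`
    calc ∏ p ∈ N.primesBelow with p ∣ h, (1 + goldbachWeight h p)
        ≤ ∏ p ∈ N.primesBelow with p ∣ h, (4 : ℝ) := by
          refine prod_le_prod (fun p hp ↦ hpos p (mem_filter.mp hp).1) fun p hp ↦ ?_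
          have hp' := mem_filter.mp hp
          exact goldbachWeight_prime_le_of_dvd h (Nat.mem_primesBelow.mp hp'.1).2 hp'.2
      _ = 4 ^ (N.primesBelow.filter (fun p ↦ p ∣ h)).card := prod_const _
      _ ≤ 4 ^ h.primeFactors.card := by
          refine pow_le_pow_right₀ (by norm_num) (card_le_card fun p hp ↦ ?_)
          have hp' := mem_filter.mp hp
          exact Nat.mem_primeFactors.mpr ⟨(Nat.mem_primesBelow.mp hp'.1).2, hp'.2, hh⟩

/-- **Summability and the Rankin bound**: `F_h` is summable and `∑_q q^{1/2}|g_h(q)| ≤ K₀ 4^{ω(h)}`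
for `h ≠ 0`. [cite: MatomakiRadziwillTao2019, §4, p. 21 (arXiv)] -/
theorem summable_goldbachWeight {h : ℕ} (hh : h ≠ 0) :
    Summable (fun q ↦ goldbachWeight h q) ∧
      ∑' q, goldbachWeight h q ≤ goldbachWeightConst * 4 ^ h.primeFactors.card :=
  summable_of_prod_primesBelow_le (isMultiplicative_goldbachWeight h) (goldbachWeight_nonneg h)
    (fun _ hq ↦ goldbachWeight_eq_zero_of_not_squarefree h hq)
    (prod_primesBelow_goldbachWeight_le hh)

/-- `g_h` is absolutely summable (`h ≠ 0`). [folklore] -/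
theorem summable_norm_goldbachSeriesTerm {h : ℕ} (hh : h ≠ 0) :
    Summable (fun q ↦ ‖goldbachSeriesTerm h q‖) :=
  Summable.of_nonneg_of_le (fun _ ↦ norm_nonneg _)
    (fun q ↦ (Real.norm_eq_abs _).le.trans (abs_goldbachSeriesTerm_le_goldbachWeight h q))
    (summable_goldbachWeight hh).1

namespace GoldbachSeries

/-- `2^{ω(h)} ≤ d(h)` for `h ≠ 0` (each prime factor contributes a factor `≥ 2` to
`d(h) = ∏ (v_p(h) + 1)`). [folklore] -/
theorem two_pow_card_primeFactors_le_card_divisors {h : ℕ} (hh : h ≠ 0) :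
    2 ^ h.primeFactors.card ≤ h.divisors.card := by
  rw [Nat.card_divisors hh]
  refine pow_card_le_prod _ _ _ fun p hp ↦ ?_
  have := (Nat.mem_primeFactors.mp hp)
  have hpos : 0 < h.factorization p := this.1.factorization_pos_of_dvd hh this.2.1
  omega

/-- `4^{ω(h)} ≤ d(h)²` for `h ≠ 0`. [folklore] -/
theorem four_pow_card_primeFactors_le {h : ℕ} (hh : h ≠ 0) :
    (4 : ℝ) ^ h.primeFactors.card ≤ (h.divisors.card : ℝ) ^ 2 := by
  have := two_pow_card_primeFactors_le_card_divisors hh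
  have h2 : ((2 : ℝ) ^ h.primeFactors.card) ≤ (h.divisors.card : ℝ) := by exact_mod_cast this
  calc (4 : ℝ) ^ h.primeFactors.card = ((2 : ℝ) ^ h.primeFactors.card) ^ 2 := by
        rw [← pow_mul, mul_comm, pow_mul]
        norm_num
    _ ≤ (h.divisors.card : ℝ) ^ 2 := by gcongr

end GoldbachSeries

/-! ### The Euler product: `∑_q g_h(q) = 𝔖(h)` -/

/-- The local Euler factor of `g_h`: `∑_{e ≥ 0} g_h(p^e) = 1 + g_h(p)` (`g_h(p^e) = 0` for `e ≥ 2`).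
[folklore] -/
theorem tsum_goldbachSeriesTerm_prime_pow (h : ℕ) {p : ℕ} (hp : p.Prime) :
    ∑' e : ℕ, goldbachSeriesTerm h (p ^ e) = 1 + goldbachSeriesTerm h p := by
  rw [tsum_eq_sum (s := {0, 1})]
  · rw [sum_pair (by norm_num), pow_zero, pow_one, (isMultiplicative_goldbachSeriesTerm h).map_one]
  · intro e he
    simp only [mem_insert, mem_singleton, not_or] at he
    rw [goldbachSeriesTerm_apply, ArithmeticFunction.moebius_apply_prime_pow hp (by omega),
      if_neg he.2]
    simp

/-- The partial Euler products of `g_h` converge to `∑_q g_h(q)` (Mathlib's Euler product for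
multiplicative summable arithmetic functions). [folklore] -/
theorem tendsto_prod_primesBelow_goldbachSeriesTerm {h : ℕ} (hh : h ≠ 0) :
    Tendsto (fun n : ℕ ↦ ∏ p ∈ n.primesBelow, (1 + goldbachSeriesTerm h p)) atTop
      (𝓝 (∑' q, goldbachSeriesTerm h q)) := by
  have E := (isMultiplicative_goldbachSeriesTerm h).eulerProduct (summable_norm_goldbachSeriesTerm hh)
  refine E.congr' (Eventually.of_forall fun n ↦ prod_congr rfl fun p hp ↦ ?_)
  exact tsum_goldbachSeriesTerm_prime_pow h (Nat.mem_primesBelow.mp hp).2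

/-- Odd `h`: the Euler factor at `p = 2` vanishes, so `∑_q g_h(q) = 0`. [cite: MatomakiRadziwillTao2019, eq. (7), p. 3 (arXiv)] -/
theorem tsum_goldbachSeriesTerm_of_odd {h : ℕ} (hodd : Odd h) :
    ∑' q, goldbachSeriesTerm h q = 0 := by
  have hh : h ≠ 0 := by rintro rfl; exact (Nat.not_odd_iff_even.mpr (by decide)) hodd
  have h2 : ¬ 2 ∣ h := fun h2 ↦ (Nat.not_even_iff_odd.mpr hodd) (even_iff_two_dvd.mpr h2)
  refine tendsto_nhds_unique (tendsto_prod_primesBelow_goldbachSeriesTerm hh)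
    (tendsto_const_nhds.congr' ?_)
  rw [EventuallyEq, eventually_atTop]
  refine ⟨3, fun n hn ↦ Eq.symm (prod_eq_zero (i := 2) ?_ ?_)⟩
  · exact Nat.mem_primesBelow.mpr ⟨by omega, Nat.prime_two⟩
  · rw [goldbachSeriesTerm_prime h Nat.prime_two, if_neg h2]
    norm_num

/-- Even `h ≠ 0`, `m ≥ h`: the partial Euler product over `p ≤ m` is
`2 · ∏_{2 < p ≤ m} (1 - 1/(p-1)²) · ∏_{p ∣ h, p > 2} (p-1)/(p-2)` (the "standard Euler product
calculation" of Matomäki–Radziwiłł–Tao 2019, p. 21). [cite: MatomakiRadziwillTao2019, §4, p. 21 (arXiv)] -/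
theorem prod_primesLE_goldbachSeriesTerm_of_even {h : ℕ} (hh : h ≠ 0) (heven : Even h) {m : ℕ}
    (hm : h ≤ m) :
    ∏ p ∈ Nat.primesLE m, (1 + goldbachSeriesTerm h p) =
      2 * twinPrimeConstPartial m *
        ∏ p ∈ h.primeFactors.filter (2 < ·), (((p : ℝ) - 1) / ((p : ℝ) - 2)) := by
  have h2h : 2 ∣ h := even_iff_two_dvd.mp heven
  have h2le : 2 ≤ h := Nat.le_of_dvd (Nat.pos_of_ne_zero hh) h2h
  have h2mem : 2 ∈ Nat.primesLE m :=
    Nat.mem_primesBelow.mpr ⟨by omega, Nat.prime_two⟩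
  rw [← mul_prod_erase _ _ h2mem, goldbachSeriesTerm_prime h Nat.prime_two, if_pos h2h]
  have h12 : (1 : ℝ) + 1 / (((2 : ℕ) : ℝ) - 1) = 2 := by norm_num
  rw [h12, mul_assoc]
  congr 1
  -- the primes `2 < p ≤ m`
  have herase : (Nat.primesLE m).erase 2 = (Nat.primesLE m).filter (2 < ·) := by
    ext p
    simp only [mem_erase, mem_filter, Nat.primesLE, Nat.mem_primesBelow]
    constructor
    · rintro ⟨hp2, hpm, hp⟩
      exact ⟨⟨hpm, hp⟩, lt_of_le_of_ne hp.two_le (Ne.symm hp2)⟩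
    · rintro ⟨⟨hpm, hp⟩, hp2⟩
      exact ⟨by omega, hpm, hp⟩
  rw [herase, twinPrimeConstPartial]
  set S := (Nat.primesLE m).filter (2 < ·) with hS
  -- split both sides according to `p ∣ h`
  have hD : S.filter (fun p ↦ p ∣ h) = h.primeFactors.filter (2 < ·) := by
    ext p
    simp only [hS, mem_filter, Nat.primesLE, Nat.mem_primesBelow, Nat.mem_primeFactors]
    constructor
    · rintro ⟨⟨⟨_, hp⟩, hp2⟩, hph⟩
      exact ⟨⟨hp, hph, hh⟩, hp2⟩
    · rintro ⟨⟨hp, hph, _⟩, hp2⟩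
      exact ⟨⟨⟨by have := Nat.le_of_dvd (Nat.pos_of_ne_zero hh) hph; omega, hp⟩, hp2⟩, hph⟩
  rw [← prod_filter_mul_prod_filter_not S (fun p ↦ p ∣ h) (fun p ↦ 1 + goldbachSeriesTerm h p),
    ← prod_filter_mul_prod_filter_not S (fun p ↦ p ∣ h) (fun p : ℕ ↦ 1 - 1 / ((p : ℝ) - 1) ^ 2),
    hD, mul_assoc, mul_comm (∏ x ∈ S with ¬x ∣ h, (1 - 1 / ((x : ℝ) - 1) ^ 2)), ← mul_assoc,
    ← prod_mul_distrib]
  congr 1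
  · refine prod_congr rfl fun p hp ↦ ?_
    have hp' := mem_filter.mp hp
    have hpp : p.Prime := (Nat.mem_primeFactors.mp hp'.1).1
    have hp3 : (3 : ℝ) ≤ p := by exact_mod_cast (show 3 ≤ p by have := hp'.2; omega)
    rw [goldbachSeriesTerm_prime h hpp, if_pos (Nat.mem_primeFactors.mp hp'.1).2.1]
    have h1 : (p : ℝ) - 1 ≠ 0 := by linarith
    have h2' : (p : ℝ) - 2 ≠ 0 := by linarith
    field_simp
    ring
  · refine prod_congr rfl fun p hp ↦ ?_
    have hp' := mem_filter.mp hp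
    have hpp : p.Prime := (Nat.mem_primesBelow.mp (mem_filter.mp hp'.1).1).2
    rw [goldbachSeriesTerm_prime h hpp, if_neg hp'.2]
    ring

/-- Even `h ≠ 0`: `∑_q g_h(q) = 2Π₂ ∏_{p ∣ h, p>2} (p-1)/(p-2) = 𝔖(h)`. [cite: MatomakiRadziwillTao2019, eq. (7), p. 3 (arXiv)] -/
theorem tsum_goldbachSeriesTerm_of_even {h : ℕ} (hh : h ≠ 0) (heven : Even h) :
    ∑' q, goldbachSeriesTerm h q = goldbachSingularSeries h := by
  rw [goldbachSingularSeries, if_neg (Nat.not_odd_iff_even.mpr heven)]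
  have T1 : Tendsto (fun m : ℕ ↦ ∏ p ∈ Nat.primesLE m, (1 + goldbachSeriesTerm h p)) atTop
      (𝓝 (∑' q, goldbachSeriesTerm h q)) :=
    (tendsto_prod_primesBelow_goldbachSeriesTerm hh).comp (tendsto_add_atTop_nat 1)
  have T2 : Tendsto (fun m : ℕ ↦ ∏ p ∈ Nat.primesLE m, (1 + goldbachSeriesTerm h p)) atTop
      (𝓝 (2 * twinPrimeConst *
        ∏ p ∈ h.primeFactors.filter (2 < ·), (((p : ℝ) - 1) / ((p : ℝ) - 2)))) := by
    have := (tendsto_twinPrimeConstPartial_holds.const_mul 2).mul_const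
      (∏ p ∈ h.primeFactors.filter (2 < ·), (((p : ℝ) - 1) / ((p : ℝ) - 2)))
    refine this.congr' ?_
    rw [EventuallyEq, eventually_atTop]
    exact ⟨h, fun m hm ↦ (prod_primesLE_goldbachSeriesTerm_of_even hh heven hm).symm⟩
  exact tendsto_nhds_unique T1 T2

/-- **The singular series as a Ramanujan-sum series** (Matomäki–Radziwiłł–Tao 2019, end of the
proof of Prop. 3.3(i): "`∑_q μ²(q) c_q(h)/φ²(q) = 𝔖(h)` … follows from a standard Euler product
calculation"): for `h ≠ 0`, `HasSum (q ↦ μ²(q) c_q(h)/φ(q)²) 𝔖(h)` with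
`𝔖(h) = Literature.goldbachSingularSeries h` (MRT eq. (7)). [cite: MatomakiRadziwillTao2019, §4, p. 21 (arXiv)] -/
theorem hasSum_goldbachSeriesTerm {h : ℕ} (hh : h ≠ 0) :
    HasSum (fun q ↦ goldbachSeriesTerm h q) (goldbachSingularSeries h) := by
  have hs := (summable_norm_goldbachSeriesTerm hh).of_norm
  rcases Nat.even_or_odd h with heven | hodd
  · rw [← tsum_goldbachSeriesTerm_of_even hh heven]
    exact hs.hasSum
  · rw [goldbachSingularSeries, if_pos hodd, ← tsum_goldbachSeriesTerm_of_odd hodd]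
    exact hs.hasSum

/-! ### Tail and size bounds in terms of `d(h)` -/

/-- **Rankin bound**: `∑_q q^{1/2} |μ²(q) c_q(h)/φ(q)²| ≤ K₀ d(h)²` for `h ≠ 0`
(Matomäki–Radziwiłł–Tao 2019, p. 21: "`≪ d₂(h)^{O(1)}`"; here with the explicit exponent `2`).
[cite: MatomakiRadziwillTao2019, §4, p. 21 (arXiv)] -/
theorem tsum_goldbachWeight_le {h : ℕ} (hh : h ≠ 0) :
    ∑' q, goldbachWeight h q ≤ goldbachWeightConst * (h.divisors.card : ℝ) ^ 2 :=
  (summable_goldbachWeight hh).2.trans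
    (mul_le_mul_of_nonneg_left (four_pow_card_primeFactors_le hh) (Real.exp_pos _).le)

/-- Crude size bound for the partial sums: `∑_{q ∈ s} |g_h(q)| ≤ K₀ d(h)²` for every finite set `s`
of moduli (`h ≠ 0`). [cite: MatomakiRadziwillTao2019, §4, p. 21 (arXiv)] -/
theorem sum_abs_goldbachSeriesTerm_le {h : ℕ} (hh : h ≠ 0) (s : Finset ℕ) :
    ∑ q ∈ s, |goldbachSeriesTerm h q| ≤ goldbachWeightConst * (h.divisors.card : ℝ) ^ 2 :=
  calc ∑ q ∈ s, |goldbachSeriesTerm h q| ≤ ∑ q ∈ s, goldbachWeight h q :=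
        sum_le_sum fun q _ ↦ abs_goldbachSeriesTerm_le_goldbachWeight h q
    _ ≤ ∑' q, goldbachWeight h q :=
        (summable_goldbachWeight hh).1.sum_le_tsum s fun q _ ↦ goldbachWeight_nonneg h q
    _ ≤ _ := tsum_goldbachWeight_le hh

/-- **Tail estimate** (Matomäki–Radziwiłł–Tao 2019, p. 21: "`∑_{q > log^B X} μ²(q)c_q(h)/φ²(q) ≪
d₂(h)^{O(1)} log^{-B/2} X`"): for `h ≠ 0` and real `Q ≥ 1`,
`|𝔖(h) - ∑_{1 ≤ q ≤ Q} μ²(q) c_q(h)/φ(q)²| ≤ K₀ d(h)² Q^{-1/2}`. [cite: MatomakiRadziwillTao2019, §4, p. 21 (arXiv)] -/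
theorem abs_goldbachSingularSeries_sub_sum_le {h : ℕ} (hh : h ≠ 0) {Q : ℝ} (hQ : 1 ≤ Q) :
    |goldbachSingularSeries h - ∑ q ∈ Icc 1 ⌊Q⌋₊, goldbachSeriesTerm h q| ≤
      goldbachWeightConst * (h.divisors.card : ℝ) ^ 2 / Real.sqrt Q := by
  set k := ⌊Q⌋₊ + 1 with hk
  have hs := (summable_norm_goldbachSeriesTerm hh).of_norm
  have hW := (summable_goldbachWeight hh).1
  have hQ0 : 0 < Q := by linarith
  have hsq0 : 0 < Real.sqrt Q := Real.sqrt_pos.mpr hQ0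
  -- `∑_{q ∈ Icc 1 ⌊Q⌋} = ∑_{q < k}` since the `q = 0` term vanishes
  have hIcc : ∑ q ∈ Icc 1 ⌊Q⌋₊, goldbachSeriesTerm h q = ∑ q ∈ range k, goldbachSeriesTerm h q := by
    rw [hk, range_eq_Ico, sum_eq_sum_Ico_succ_bot (Nat.succ_pos _), ArithmeticFunction.map_zero,
      zero_add]
    rfl
  -- the tail `∑_{q ≥ k} g_h(q)`
  have htail : goldbachSingularSeries h - ∑ q ∈ Icc 1 ⌊Q⌋₊, goldbachSeriesTerm h q =
      ∑' i, goldbachSeriesTerm h (i + k) := by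
    rw [hIcc, ← (hasSum_goldbachSeriesTerm hh).tsum_eq, ← hs.sum_add_tsum_nat_add k,
      add_sub_cancel_left]
  rw [htail]
  have hs' : Summable fun i ↦ ‖goldbachSeriesTerm h (i + k)‖ :=
    (summable_nat_add_iff k).mpr (summable_norm_goldbachSeriesTerm hh)
  have hW' : Summable fun i ↦ goldbachWeight h (i + k) := (summable_nat_add_iff k).mpr hW
  -- pointwise: `|g_h(q)| ≤ F_h(q)/√Q` for `q ≥ k > Q`
  have hpt : ∀ i, ‖goldbachSeriesTerm h (i + k)‖ ≤ goldbachWeight h (i + k) / Real.sqrt Q := by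
    intro i
    have hik : Q ≤ ((i + k : ℕ) : ℝ) := by
      have : Q < k := by rw [hk]; push_cast; exact Nat.lt_floor_add_one Q
      push_cast at this ⊢
      linarith
    have hsqrt : Real.sqrt Q ≤ Real.sqrt ((i + k : ℕ) : ℝ) := Real.sqrt_le_sqrt hik
    rw [Real.norm_eq_abs, le_div_iff₀ hsq0, goldbachWeight_apply, mul_comm]
    exact mul_le_mul_of_nonneg_right hsqrt (abs_nonneg _)
  -- the tail of the majorant is at most its total
  have hWtail : ∑' i, goldbachWeight h (i + k) ≤ ∑' q, goldbachWeight h q := by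
    rw [← hW.sum_add_tsum_nat_add k]
    linarith [sum_nonneg (fun q (_ : q ∈ range k) ↦ goldbachWeight_nonneg h q)]
  calc |∑' i, goldbachSeriesTerm h (i + k)| = ‖∑' i, goldbachSeriesTerm h (i + k)‖ :=
        (Real.norm_eq_abs _).symm
    _ ≤ ∑' i, ‖goldbachSeriesTerm h (i + k)‖ := norm_tsum_le_tsum_norm hs'
    _ ≤ ∑' i, goldbachWeight h (i + k) / Real.sqrt Q :=
        hs'.tsum_le_tsum hpt (hW'.div_const _)
    _ = (∑' i, goldbachWeight h (i + k)) / Real.sqrt Q := tsum_div_const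
    _ ≤ (∑' q, goldbachWeight h q) / Real.sqrt Q := by gcongr
    _ ≤ goldbachWeightConst * (h.divisors.card : ℝ) ^ 2 / Real.sqrt Q := by
        gcongr
        exact tsum_goldbachWeight_le hh

end Literature.NumberTheory.Sieve

end
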